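import Summits.HubbardSuperconductivity.HubbardSuperconductivity.Theorems.WidthHaldaneColumnCorrelatorBounds
import Summits.HubbardSuperconductivity.HubbardSuperconductivity.Theorems.WidthHaldaneTubeKinematics
import Literature.MathematicalPhysics.QuantumLattice.FinDimSpectrumSectorGibbsLimit
import Literature.MathematicalPhysics.QuantumLattice.PairCorrelationsProofs

/-!
# Energy response of a sector minimum bounds ground-state expectations (the duality engine)

Crux `WidthHaldaneBridge` (stmt-HubbardSuperconductivity-16311) asks a floor on the column pair
correlator `G_ψ(r)` in EVERY normalised sector ground state `ψ` of the pure tube. Two crux ideas of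
the 2026-08-17 round — `frustration-cost-duality` (first lemma `FrustrationCostEngine`) and
`pair-repulsion-dual` (first lemma `haldaneLaw_of_dual`) — rest on one elementary engine, the
variational principle read as a DUALITY between sector-energy responses and ground-state
expectations:

  if `ψ ∈ K` is a unit eigenvector of `H` at the sector minimum `E_K(H)`, then for every Hermitian
  `V`:  `E_K(H + V) ≤ E_K(H) + Re⟨ψ, V ψ⟩`;

so ANY lower bound on the energy response `E_K(H + hV) - E_K(H) ≥ h·c` (`h > 0`) is a floor
`c ≤ Re⟨ψ, Vψ⟩` holding for every ground state of the sector at once (degenerate ground spaces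
included), and conversely an energy CEILING follows from any one ground-state expectation. With
`V = X_r = Σ_a (Φ_a† Φ_{a+r} + Φ_{a+r}† Φ_a)` (the symmetrised column pair–pair coupling, whose
expectation is `2G_ψ(r)`) the crux's conclusion becomes an inequality between sector minima of two
explicit Hermitian matrices — the input format of positivity certificates (card `pair-repulsion-dual`)
and of the Feshbach/low-energy-window programme (card `frustration-cost-duality`).

This file PROVES the engine and its tube specialisation, def-free (the operator `X_r` is written out;
a line that names it `pairRepulsion`/`columnJosephson` gets these lemmas by `rfl`):

* `minEnergyOn_add_le_of_eigen` — `E_K(H + V) ≤ E + Re⟨ψ, Vψ⟩` for a unit `ψ ∈ K` with `Hψ = Eψ`;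
  `minEnergyOn_add_smul_le_of_eigen` — the same for `H + νV`, `ν` real: `≤ E + ν·Re⟨ψ, Vψ⟩`;
* `le_re_expect_of_minEnergyOn_add_smul_ge` — the FLOOR TRANSFER: `E + h·c ≤ E_K(H + hV)`, `h > 0`
  ⇒ `c ≤ Re⟨ψ, Vψ⟩`;
* `energyResponse_le` — closed form on the tubes (the registered sub-goal; card
  `frustration-cost-duality`'s `FrustrationCostEngine` for Hermitian `V`);
* `isHermitian_columnPairRepulsion`, `re_expect_columnPairRepulsion` — `X_r` is Hermitian and
  `Re⟨ψ, X_r ψ⟩ = 2G_ψ(r)`;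
* **`tubeColumnPairCorr_ge_of_energy_floor`** — the dual (energy) form of the Haldane floor implies
  the floor: `E₀ + h·2F ≤ E_{(N,0)}(tubeH0 + h·X_r)`, `h > 0` ⇒ `F ≤ G_ψ(r)` for every normalised
  `(N, S^z = 0)` ground state `ψ` of `tubeH0` (card `pair-repulsion-dual`'s `haldaneLaw_of_dual`,
  pointwise core).

Elementary (variational principle `minEnergyOn_le_rayleigh_of_mem` only); these are handles for the
lines of the crux, not progress on its open core. Prior art for the engine: Weinhold, J. Phys. A 1
(1968) 305 (lower bounds to expectation values from energy bounds); Wang et al., PRX 14 (2024) 031006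
(certified ground-state observables from energy constraints).
-/

noncomputable section

namespace Summit.HubbardSuperconductivity.HubbardSuperconductivity.Theorems.WidthHaldane

set_option linter.dupNamespace false -- summit = problem name (single-conjunct summit), D-0017

open scoped BigOperators Classical Matrix ComplexConjugate ComplexOrder
open Matrix Literature.MathematicalPhysics.QuantumLattice

/-! ### The engine: variational duality between energy responses and expectations -/

section Engine

variable {n : Type*} [Fintype n] [DecidableEq n]

/-- **Energy response is bounded by the ground-state expectation.** If `ψ ∈ K` is a unit vector with
`Hψ = Eψ` (`E` real) and `H`, `V` are Hermitian, then `E_K(H + V) ≤ E + Re⟨ψ, Vψ⟩` (price `ψ` in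
`H + V`). Tasaki (2020) §2.2; Weinhold, J. Phys. A 1 (1968) 305. [folklore] -/
theorem minEnergyOn_add_le_of_eigen {H V : Matrix n n ℂ} (hH : H.IsHermitian) (hV : V.IsHermitian)
    (K : Submodule ℂ (n → ℂ)) {ψ : n → ℂ} (hψ : ψ ∈ K) (h1 : star ψ ⬝ᵥ ψ = 1) {E : ℝ}
    (hHψ : H *ᵥ ψ = (E : ℂ) • ψ) :
    (H + V).minEnergyOn K ≤ E + (star ψ ⬝ᵥ V *ᵥ ψ).re := by
  have hle := minEnergyOn_le_rayleigh_of_mem (hH.add hV) K hψ h1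
  rw [add_mulVec, dotProduct_add, Complex.add_re, hHψ, dotProduct_smul, h1, smul_eq_mul, mul_one,
    Complex.ofReal_re] at hle
  exact hle

/-- **Scaled form**: for real `ν`, `E_K(H + νV) ≤ E + ν·Re⟨ψ, Vψ⟩`. [folklore] -/
theorem minEnergyOn_add_smul_le_of_eigen {H V : Matrix n n ℂ} (hH : H.IsHermitian)
    (hV : V.IsHermitian) (K : Submodule ℂ (n → ℂ)) {ψ : n → ℂ} (hψ : ψ ∈ K)
    (h1 : star ψ ⬝ᵥ ψ = 1) {E : ℝ} (hHψ : H *ᵥ ψ = (E : ℂ) • ψ) (ν : ℝ) :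
    (H + (ν : ℂ) • V).minEnergyOn K ≤ E + ν * (star ψ ⬝ᵥ V *ᵥ ψ).re := by
  have hνV : ((ν : ℂ) • V).IsHermitian := by
    rw [IsHermitian, conjTranspose_smul, hV.eq, Complex.star_def, Complex.conj_ofReal]
  have h := minEnergyOn_add_le_of_eigen hH hνV K hψ h1 hHψ
  rw [smul_mulVec, dotProduct_smul, smul_eq_mul, Complex.re_ofReal_mul] at h
  exact h

/-- **Floor transfer (the duality engine)**: an energy floor for the perturbed sector minimum,
`E + h·c ≤ E_K(H + hV)` with `h > 0`, is a floor `c ≤ Re⟨ψ, Vψ⟩` on the expectation of `V` in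
EVERY unit `E`-eigenvector `ψ ∈ K` of `H` — degenerate ground spaces included. Weinhold, J. Phys. A 1
(1968) 305; Wang et al., PRX 14 (2024) 031006, §3. [folklore] -/
theorem le_re_expect_of_minEnergyOn_add_smul_ge {H V : Matrix n n ℂ} (hH : H.IsHermitian)
    (hV : V.IsHermitian) (K : Submodule ℂ (n → ℂ)) {ψ : n → ℂ} (hψ : ψ ∈ K)
    (h1 : star ψ ⬝ᵥ ψ = 1) {E : ℝ} (hHψ : H *ᵥ ψ = (E : ℂ) • ψ) {h c : ℝ} (hh : 0 < h)
    (hfloor : E + h * c ≤ (H + (h : ℂ) • V).minEnergyOn K) :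
    c ≤ (star ψ ⬝ᵥ V *ᵥ ψ).re := by
  have hle := minEnergyOn_add_smul_le_of_eigen hH hV K hψ h1 hHψ h
  have key : h * c ≤ h * (star ψ ⬝ᵥ V *ᵥ ψ).re := by linarith
  exact le_of_mul_le_mul_left key hh

end Engine

/-! ### On the tubes -/

section Tube

variable (L M : ℕ) [NeZero L] [NeZero M] (Λ : Type) [LinearOrder Λ] [Fintype Λ]
  (e : Λ ≃ ZMod L × ZMod M)

omit [NeZero L] [NeZero M] in
/-- **Energy response of the tube's sector minimum** (card `frustration-cost-duality`'s engine, for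
Hermitian perturbations): for every Hermitian `V`, every real `ν` and every normalised ground state
`ψ` of `tubeH0` in the sector `(N, S^z = 0)`,
`E_{(N,0)}(tubeH0 + νV) - E_{(N,0)}(tubeH0) ≤ ν·Re⟨ψ, Vψ⟩`. [folklore] -/
theorem tubeEnergyResponse_le (U : ℝ) (N : ℕ) {V : Matrix (Finset (Orb Λ)) (Finset (Orb Λ)) ℂ}
    (hV : V.IsHermitian) (ν : ℝ) {ψ : Fock (Orb Λ)} (hψ : star ψ ⬝ᵥ ψ = 1)
    (hgs : IsGroundStateInSector (tubeH0 L M Λ e U) N 0 ψ) :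
    (tubeH0 L M Λ e U + (ν : ℂ) • V).minEnergyOn (szSector N 0) -
        (tubeH0 L M Λ e U).minEnergyOn (szSector N 0) ≤ ν * (expect V ψ).re := by
  have h := minEnergyOn_add_smul_le_of_eigen (isHermitian_tubeH0 L M Λ e U) hV (szSector N 0) hgs.1
    hψ hgs.2.2 ν
  rw [expect]
  linarith

/-- The symmetrised column pair–pair coupling `X_r = Σ_a (Φ_a† Φ_{a+r} + Φ_{a+r}† Φ_a)`,
`Φ_a = Σ_b P_{e⁻¹(a,b)}`, is Hermitian. [folklore] -/
theorem isHermitian_columnPairRepulsion (r : ZMod L) :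
    (∑ a : ZMod L,
      ((∑ b : ZMod M, tubeDWavePair L M Λ e (e.symm (a, b)))ᴴ *
          (∑ b : ZMod M, tubeDWavePair L M Λ e (e.symm (a + r, b))) +
        (∑ b : ZMod M, tubeDWavePair L M Λ e (e.symm (a + r, b)))ᴴ *
          (∑ b : ZMod M, tubeDWavePair L M Λ e (e.symm (a, b))))).IsHermitian := by
  rw [IsHermitian, conjTranspose_sum]
  refine Finset.sum_congr rfl fun a _ => ?_
  rw [conjTranspose_add, conjTranspose_mul, conjTranspose_mul, conjTranspose_conjTranspose,
    conjTranspose_conjTranspose, add_comm]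

/-- `Re⟨ψ, X_r ψ⟩ = 2·G_ψ(r)` for the symmetrised column pair–pair coupling `X_r`. [folklore] -/
theorem re_expect_columnPairRepulsion (ψ : Fock (Orb Λ)) (r : ZMod L) :
    (expect (∑ a : ZMod L,
      ((∑ b : ZMod M, tubeDWavePair L M Λ e (e.symm (a, b)))ᴴ *
          (∑ b : ZMod M, tubeDWavePair L M Λ e (e.symm (a + r, b))) +
        (∑ b : ZMod M, tubeDWavePair L M Λ e (e.symm (a + r, b)))ᴴ *
          (∑ b : ZMod M, tubeDWavePair L M Λ e (e.symm (a, b))))) ψ).re =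
      2 * tubeColumnPairCorr L M Λ e ψ r := by
  rw [tubeColumnPairCorr_eq_sum_dotProduct, expect_sum, Complex.re_sum, Finset.mul_sum]
  refine Finset.sum_congr rfl fun a _ => ?_
  rw [expect_add, Complex.add_re, PosSemidefTrace.expect_conjTranspose_mul,
    PosSemidefTrace.expect_conjTranspose_mul]
  have key : star ((∑ b : ZMod M, tubeDWavePair L M Λ e (e.symm (a + r, b))) *ᵥ ψ) ⬝ᵥ
      ((∑ b : ZMod M, tubeDWavePair L M Λ e (e.symm (a, b))) *ᵥ ψ) =
      star (star ((∑ b : ZMod M, tubeDWavePair L M Λ e (e.symm (a, b))) *ᵥ ψ) ⬝ᵥ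
        ((∑ b : ZMod M, tubeDWavePair L M Λ e (e.symm (a + r, b))) *ᵥ ψ)) :=
    star_dotProduct _ _
  rw [key, Complex.star_def, Complex.conj_re]
  ring

/-- **The dual (energy) form of the Haldane floor implies the floor** (card `pair-repulsion-dual`'s
first lemma, pointwise core): if for some `h > 0` the REPULSIVE pair–pair source `h·X_r` raises the
`(N, S^z = 0)` sector minimum of the pure tube by at least `h·2F`,
`E_{(N,0)}(tubeH0) + h·2F ≤ E_{(N,0)}(tubeH0 + h·X_r)`, then `F ≤ G_ψ(r)` for EVERY normalised
`(N, S^z = 0)` sector ground state `ψ` of `tubeH0`. Only sector minima of explicit Hermitian matrices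
occur in the hypothesis — no eigenvector, no "every ground state". [folklore] -/
theorem tubeColumnPairCorr_ge_of_energy_floor (U : ℝ) (N : ℕ) (r : ZMod L) {h F : ℝ} (hh : 0 < h)
    (hfloor : (tubeH0 L M Λ e U).minEnergyOn (szSector N 0) + h * (2 * F) ≤
      (tubeH0 L M Λ e U + (h : ℂ) • ∑ a : ZMod L,
        ((∑ b : ZMod M, tubeDWavePair L M Λ e (e.symm (a, b)))ᴴ *
            (∑ b : ZMod M, tubeDWavePair L M Λ e (e.symm (a + r, b))) +
          (∑ b : ZMod M, tubeDWavePair L M Λ e (e.symm (a + r, b)))ᴴ *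
            (∑ b : ZMod M, tubeDWavePair L M Λ e (e.symm (a, b))))).minEnergyOn (szSector N 0))
    {ψ : Fock (Orb Λ)} (hψ : star ψ ⬝ᵥ ψ = 1)
    (hgs : IsGroundStateInSector (tubeH0 L M Λ e U) N 0 ψ) :
    F ≤ tubeColumnPairCorr L M Λ e ψ r := by
  have h2 := le_re_expect_of_minEnergyOn_add_smul_ge (isHermitian_tubeH0 L M Λ e U)
    (isHermitian_columnPairRepulsion L M Λ e r) (szSector N 0) hgs.1 hψ hgs.2.2 hh hfloor
  rw [← expect, re_expect_columnPairRepulsion] at h2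
  linarith

end Tube

/-- **ENERGY RESPONSE BOUND, closed form** (all binders universally quantified; the registered
sub-goal `energyResponse_le` of crux stmt-HubbardSuperconductivity-16311 — card
`frustration-cost-duality`'s `FrustrationCostEngine` for Hermitian perturbations): for every labelled
tube, every `U`, `N`, every Hermitian `V`, every real `ν` and every normalised `(N, S^z = 0)` sector
ground state `ψ` of `tubeH0`: `E_{(N,0)}(tubeH0 + νV) - E_{(N,0)}(tubeH0) ≤ ν·Re⟨ψ, Vψ⟩`. [folklore] -/
theorem energyResponse_le : ∀ (L M : ℕ) [NeZero L] [NeZero M] (Λ : Type) [LinearOrder Λ] [Fintype Λ] (e : Λ ≃ ZMod L × ZMod M) (U : ℝ) (N : ℕ) (V : Matrix (Finset (Orb Λ)) (Finset (Orb Λ)) ℂ) (ν : ℝ), V.IsHermitian → ∀ ψ : Fock (Orb Λ), star ψ ⬝ᵥ ψ = 1 → IsGroundStateInSector (tubeH0 L M Λ e U) N 0 ψ → (tubeH0 L M Λ e U + (ν : ℂ) • V).minEnergyOn (szSector N 0) - (tubeH0 L M Λ e U).minEnergyOn (szSector N 0) ≤ ν * (expect V ψ).re :=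
  fun L M _ _ Λ _ _ e U N _V ν hV _ψ hψ hgs => tubeEnergyResponse_le L M Λ e U N hV ν hψ hgs

end Summit.HubbardSuperconductivity.HubbardSuperconductivity.Theorems.WidthHaldane

end
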